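import Mathlib.LinearAlgebra.Lagrange
import Mathlib.Analysis.Complex.CauchyIntegral
import Mathlib.Analysis.Calculus.IteratedDeriv.Lemmas
import Mathlib.Algebra.Polynomial.Derivative
import Mathlib.Data.Nat.Choose.Sum
import Literature.NumberTheory.Transcendental.BakerLogarithmsAnalytic
import HarnessLib

/-!
# A maximum-modulus ("Schwarz") lemma with approximate zeros (Masser 1975, §1.3, eq. (14))

Support for the proof of Theorem I of D. W. Masser, *Elliptic Functions and Transcendence*,
LNM 437 (1975), Ch. I, on the book's own line towards Theorem II
(`Literature.NumberTheory.Transcendental.masser_ellipticPeriods`). In the proofs of Lemmas 1.10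
and 1.11 the auxiliary function `φ` does NOT vanish at the points `s + 1/4`; only its derivatives
of order `< k` are small there. The book extrapolates with the interpolation formula
`φ(ζ)/F(ζ) = (2πi)⁻¹ ∮_C φ(z) dz/((z-ζ)F(z)) - (2πi)⁻¹ ∑_{m,s} φ_m(s+¼)/m! · I(m, s)` (eq. (14),
p. 8; `F(z) = ∏_s (z - s - ¼)^k`), i.e. the residue theorem for `φ/((z-ζ)F)`.

Mathlib has no residue theorem, so we prove the same estimate through an explicit
quasi-interpolant: for an entire `f`, distinct points `c₁, …, c_h` and an order `S` let
`T_s` be the Taylor polynomial of `f` of order `S` at `c_s`, `ℓ_s` the Lagrange basis polynomial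
(`Lagrange.basis`) and `E_s = ∑_{j=S}^{2S-1} binom(2S-1, j) ℓ_s^j (1 - ℓ_s)^{2S-1-j}` (so that
`E_s ≡ 1 mod (z - c_s)^S`, `E_s ≡ 0 mod (z - c_t)^S` for `t ≠ s`, by the binomial theorem);
then `q = ∑_s T_s E_s` (`quasiInterp`) satisfies `ord_{c_s}(f - q) ≥ S` for every `s`
(`le_analyticOrderAt_sub_quasiInterp`), so the exact maximum-modulus lemma of the tree
(`Baker1975.Analytic.norm_le_of_analyticOrderAt`) applies to `f - q` and gives
`|f(w)| ≤ |q(w)| + (θ + Q)/m · |F(w)|` (`norm_le_of_small_derivs`), while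
`|q(z)| ≤ ∑_s (∑_{m<S} |f^{(m)}(c_s)|/m! |z - c_s|^m)(1 + 2|ℓ_s(z)|)^{2S-1}` (`norm_quasiInterp_le`)
is explicit in the small derivatives — which is what (14) is used for.

Everything here is proved; no named facts.

## References

* D. W. Masser, *Elliptic Functions and Transcendence*, Lecture Notes in Math. 437, Springer 1975,
  Ch. I §1.3, proof of Lemma 1.10, eq. (14) (p. 8), and Lemma 1.11. [Masser1975]
* A. Baker, *Transcendental Number Theory*, CUP 1975, Ch. 2 Lemma 4 (the exact form). [Baker1975]
-/

noncomputable section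

open Polynomial Finset Complex Metric

namespace Literature.NumberTheory.Transcendental.Masser1975

variable {h : ℕ} (c : Fin h → ℂ) (S : ℕ)

/-! ### The polynomials `E_s` -/

/-- `E_s = ∑_{j=S}^{2S-1} binom(2S-1, j) ℓ_s^j (1-ℓ_s)^{2S-1-j}` with `ℓ_s` the Lagrange basis
polynomial at the nodes `c`. [folklore] -/
def bump (s : Fin h) : ℂ[X] :=
  ∑ j ∈ Finset.Ico S (2 * S), (Lagrange.basis univ c s) ^ j *
    (1 - Lagrange.basis univ c s) ^ (2 * S - 1 - j) * (((2 * S - 1).choose j : ℕ) : ℂ[X])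

/-- The complementary sum: `1 - E_s = ∑_{j<S} binom(2S-1, j) ℓ_s^j (1-ℓ_s)^{2S-1-j}` (binomial
theorem for `(ℓ_s + (1 - ℓ_s))^{2S-1}`). [folklore] -/
theorem one_sub_bump (hS : 1 ≤ S) (s : Fin h) :
    1 - bump c S s = ∑ j ∈ Finset.range S, (Lagrange.basis univ c s) ^ j *
      (1 - Lagrange.basis univ c s) ^ (2 * S - 1 - j) * (((2 * S - 1).choose j : ℕ) : ℂ[X]) := by
  have hbin := add_pow (Lagrange.basis univ c s) (1 - Lagrange.basis univ c s) (2 * S - 1)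
  rw [add_sub_cancel, one_pow, show 2 * S - 1 + 1 = 2 * S by omega,
    ← Finset.sum_range_add_sum_Ico _ (show S ≤ 2 * S by omega)] at hbin
  rw [bump, sub_eq_iff_eq_add]
  exact hbin

/-- `(X - c_t)` divides `ℓ_s` for `t ≠ s`. [folklore] -/
theorem X_sub_C_dvd_basis {s t : Fin h} (hst : t ≠ s) :
    X - C (c t) ∣ Lagrange.basis univ c s := by
  rw [Polynomial.dvd_iff_isRoot, IsRoot.def]
  exact Lagrange.eval_basis_of_ne hst.symm (mem_univ t)

/-- `(X - c_t)^S` divides `E_s` for `t ≠ s`. [folklore] -/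
theorem pow_dvd_bump {s t : Fin h} (hst : t ≠ s) : (X - C (c t)) ^ S ∣ bump c S s := by
  unfold bump
  refine Finset.dvd_sum fun j hj => ?_
  have hSj : S ≤ j := (Finset.mem_Ico.mp hj).1
  exact ((pow_dvd_pow_of_dvd (X_sub_C_dvd_basis c hst) S).trans
    (pow_dvd_pow _ hSj)).mul_right _ |>.mul_right _

/-- `(X - c_s)` divides `1 - ℓ_s` (injective nodes). [folklore] -/
theorem X_sub_C_dvd_one_sub_basis (hc : Function.Injective c) (s : Fin h) :
    X - C (c s) ∣ 1 - Lagrange.basis univ c s := by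
  rw [Polynomial.dvd_iff_isRoot, IsRoot.def, eval_sub, eval_one,
    Lagrange.eval_basis_self hc.injOn (mem_univ s), sub_self]

/-- `(X - c_s)^S` divides `1 - E_s`. [folklore] -/
theorem pow_dvd_one_sub_bump (hc : Function.Injective c) (hS : 1 ≤ S) (s : Fin h) :
    (X - C (c s)) ^ S ∣ 1 - bump c S s := by
  rw [one_sub_bump c S hS s]
  refine Finset.dvd_sum fun j hj => ?_
  have hj' : j < S := Finset.mem_range.mp hj
  have hle : S ≤ 2 * S - 1 - j := by omega
  exact (((pow_dvd_pow_of_dvd (X_sub_C_dvd_one_sub_basis c hc s) S).trans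
    (pow_dvd_pow _ hle)).mul_left _).mul_right _

/-! ### Taylor polynomials and the quasi-interpolant -/

/-- The Taylor polynomial `T_s = ∑_{m<S} f^{(m)}(c_s)/m! (X - c_s)^m`. [folklore] -/
def taylorPoly (f : ℂ → ℂ) (s : Fin h) : ℂ[X] :=
  ∑ m ∈ Finset.range S, C (iteratedDeriv m f (c s) / m.factorial) * (X - C (c s)) ^ m

/-- **The quasi-interpolant** `q = ∑_s T_s E_s` (a polynomial agreeing with `f` to order `S` at
every `c_s`). [cite: Masser1975, §1.3 (proof of Lemma 1.10, eq. (14))] -/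
def quasiInterp (f : ℂ → ℂ) : ℂ[X] := ∑ s, taylorPoly c S f s * bump c S s

/-- Iterated derivatives of a polynomial function are the evaluations of the iterated formal
derivatives. [folklore] -/
theorem iteratedDeriv_eval_poly (p : ℂ[X]) (n : ℕ) (x : ℂ) :
    iteratedDeriv n (fun y => p.eval y) x = (derivative^[n] p).eval x := by
  induction n generalizing x with
  | zero => simp
  | succ n ih =>
    rw [iteratedDeriv_succ, Function.iterate_succ_apply']
    have : iteratedDeriv n (fun y => p.eval y) = fun y => (derivative^[n] p).eval y := funext ih
    rw [this, Polynomial.deriv]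

/-- If `(X - a)^S ∣ p` then `(X - a)^{S-m} ∣ p^{(m)}`. [folklore] -/
theorem pow_sub_dvd_iterate_derivative {p : ℂ[X]} {a : ℂ} {N : ℕ} (hp : (X - C a) ^ N ∣ p)
    (m : ℕ) : (X - C a) ^ (N - m) ∣ derivative^[m] p := by
  induction m with
  | zero => simpa using hp
  | succ m ih =>
    obtain ⟨r, hr⟩ := ih
    rw [Function.iterate_succ_apply', hr, derivative_mul, derivative_pow, derivative_sub,
      derivative_X, derivative_C, sub_zero, mul_one]
    refine dvd_add ?_ ?_
    · -- `C (N-m) (X-a)^(N-m-1) r`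
      rcases Nat.eq_zero_or_pos (N - m) with h0 | hpos
      · rw [h0]
        simp
      · refine Dvd.dvd.mul_right ?_ r
        refine Dvd.dvd.mul_left ?_ _
        exact pow_dvd_pow _ (by omega)
    · exact (pow_dvd_pow _ (by omega)).mul_right _

/-- Hence `p^{(m)}(a) = 0` for `m < N` if `(X - a)^N ∣ p`. [folklore] -/
theorem eval_iterate_derivative_eq_zero {p : ℂ[X]} {a : ℂ} {N : ℕ} (hp : (X - C a) ^ N ∣ p)
    {m : ℕ} (hm : m < N) : (derivative^[m] p).eval a = 0 := by
  obtain ⟨r, hr⟩ := pow_sub_dvd_iterate_derivative hp m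
  rw [hr, eval_mul, eval_pow, eval_sub, eval_X, eval_C, sub_self, zero_pow (by omega), zero_mul]

/-- The Taylor polynomial has the right derivatives: `T_s^{(m)}(c_s) = f^{(m)}(c_s)` for `m < S`.
[folklore] -/
theorem eval_iterate_derivative_taylorPoly (f : ℂ → ℂ) (s : Fin h) {m : ℕ} (hm : m < S) :
    (derivative^[m] (taylorPoly c S f s)).eval (c s) = iteratedDeriv m f (c s) := by
  unfold taylorPoly
  rw [iterate_derivative_sum]
  simp only [iterate_derivative_C_mul, iterate_derivative_X_sub_pow, eval_finsetSum, eval_mul,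
    eval_C, eval_pow, eval_sub, eval_X, sub_self, nsmul_eq_mul, eval_natCast]
  rw [Finset.sum_eq_single m]
  · rw [Nat.sub_self, pow_zero, mul_one, Nat.descFactorial_self]
    have hm0 : (m.factorial : ℂ) ≠ 0 := by exact_mod_cast m.factorial_ne_zero
    field_simp
  · intro k _ hkm
    rcases lt_or_gt_of_ne hkm with hlt | hgt
    · rw [Nat.descFactorial_eq_zero_iff_lt.mpr hlt]
      simp
    · rw [zero_pow (Nat.sub_ne_zero_of_lt hgt)]
      simp
  · intro hm'
    exact absurd (Finset.mem_range.mpr hm) hm'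

/-- `(X - c_s)^S` divides `q - T_s`. [folklore] -/
theorem pow_dvd_quasiInterp_sub (hc : Function.Injective c) (hS : 1 ≤ S) (f : ℂ → ℂ) (s : Fin h) :
    (X - C (c s)) ^ S ∣ quasiInterp c S f - taylorPoly c S f s := by
  have hsplit : quasiInterp c S f - taylorPoly c S f s =
      taylorPoly c S f s * (bump c S s - 1) +
        ∑ t ∈ univ.erase s, taylorPoly c S f t * bump c S t := by
    unfold quasiInterp
    rw [← Finset.add_sum_erase _ _ (mem_univ s)]
    ring
  rw [hsplit]
  refine dvd_add ?_ (Finset.dvd_sum fun t ht => ?_)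
  · refine Dvd.dvd.mul_left ?_ _
    have h1 := pow_dvd_one_sub_bump c S hc hS s
    have h2 : bump c S s - 1 = -(1 - bump c S s) := by ring
    rw [h2]
    exact h1.neg_right
  · exact (pow_dvd_bump c S (ne_of_mem_erase ht).symm).mul_left _

/-- **Order of contact**: `f - q` vanishes to order `≥ S` at every node (`f` entire, nodes
distinct, `S ≥ 1`). [cite: Masser1975, §1.3 (proof of Lemma 1.10, eq. (14))] -/
theorem le_analyticOrderAt_sub_quasiInterp {f : ℂ → ℂ} (hf : Differentiable ℂ f)
    (hc : Function.Injective c) (hS : 1 ≤ S) (s : Fin h) :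
    (S : ℕ∞) ≤ analyticOrderAt (fun z => f z - (quasiInterp c S f).eval z) (c s) := by
  have hq : Differentiable ℂ fun z => (quasiInterp c S f).eval z := Polynomial.differentiable _
  refine Baker1975.Analytic.le_analyticOrderAt_of_iteratedDeriv_eq_zero
    (f := fun z => f z - (quasiInterp c S f).eval z) (hf.sub hq) ?_
  intro m hm
  have h1 : iteratedDeriv m (fun z => f z - (quasiInterp c S f).eval z) (c s) =
      iteratedDeriv m f (c s) - iteratedDeriv m (fun z => (quasiInterp c S f).eval z) (c s) := by
    have := iteratedDeriv_sub (n := m) (x := c s) (hf.contDiff.contDiffAt) (hq.contDiff.contDiffAt)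
    exact this
  rw [h1, iteratedDeriv_eval_poly, sub_eq_zero]
  obtain ⟨P, hP⟩ := pow_dvd_quasiInterp_sub c S hc hS f s
  rw [sub_eq_iff_eq_add'] at hP
  rw [hP, iterate_map_add, eval_add, eval_iterate_derivative_taylorPoly c S f s hm,
    eval_iterate_derivative_eq_zero (dvd_mul_right _ P) hm, add_zero]

/-! ### Sizes -/

/-- `|ℓ_s(z)| = ∏_{t ≠ s} |z - c_t| / |c_s - c_t|`. [folklore] -/
theorem norm_lagrange_basis_eval (s : Fin h) (z : ℂ) :
    ‖(Lagrange.basis univ c s).eval z‖ = ∏ t ∈ univ.erase s, ‖z - c t‖ / ‖c s - c t‖ := by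
  classical
  rw [Lagrange.basis, eval_prod, norm_prod]
  refine Finset.prod_congr rfl fun t _ => ?_
  rw [Lagrange.basisDivisor, eval_mul, eval_C, eval_sub, eval_X, eval_C, norm_mul, norm_inv,
    div_eq_inv_mul]

/-- `|E_s(z)| ≤ (1 + 2|ℓ_s(z)|)^{2S-1}`. [folklore] -/
theorem norm_bump_eval_le (s : Fin h) (z : ℂ) :
    ‖(bump c S s).eval z‖ ≤ (1 + 2 * ‖(Lagrange.basis univ c s).eval z‖) ^ (2 * S - 1) := by
  set ℓ : ℂ := (Lagrange.basis univ c s).eval z with hℓ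
  have hterm : ∀ j, ‖((Lagrange.basis univ c s) ^ j * (1 - Lagrange.basis univ c s) ^ (2 * S - 1 - j) *
      (((2 * S - 1).choose j : ℕ) : ℂ[X])).eval z‖ = ‖ℓ‖ ^ j * ‖1 - ℓ‖ ^ (2 * S - 1 - j) *
        ((2 * S - 1).choose j : ℝ) := by
    intro j
    rw [eval_mul, eval_mul, eval_pow, eval_pow, eval_sub, eval_one, eval_natCast, norm_mul,
      norm_mul, norm_pow, norm_pow, Complex.norm_natCast]
  unfold bump
  rw [eval_finsetSum]
  calc ‖∑ j ∈ Finset.Ico S (2 * S), ((Lagrange.basis univ c s) ^ j *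
        (1 - Lagrange.basis univ c s) ^ (2 * S - 1 - j) * (((2 * S - 1).choose j : ℕ) : ℂ[X])).eval z‖
      ≤ ∑ j ∈ Finset.Ico S (2 * S), ‖ℓ‖ ^ j * ‖1 - ℓ‖ ^ (2 * S - 1 - j) * ((2 * S - 1).choose j : ℝ) := by
        refine (norm_sum_le _ _).trans (le_of_eq (Finset.sum_congr rfl fun j _ => hterm j))
    _ ≤ ∑ j ∈ Finset.range (2 * S - 1 + 1), ‖ℓ‖ ^ j * ‖1 - ℓ‖ ^ (2 * S - 1 - j) *
        ((2 * S - 1).choose j : ℝ) := by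
        refine Finset.sum_le_sum_of_subset_of_nonneg ?_ (fun j _ _ => by positivity)
        intro j hj
        rw [Finset.mem_range]
        have := (Finset.mem_Ico.mp hj).2
        omega
    _ = (‖ℓ‖ + ‖1 - ℓ‖) ^ (2 * S - 1) := (add_pow ‖ℓ‖ ‖1 - ℓ‖ (2 * S - 1)).symm
    _ ≤ (1 + 2 * ‖ℓ‖) ^ (2 * S - 1) := by
        refine pow_le_pow_left₀ (by positivity) ?_ _
        have : ‖1 - ℓ‖ ≤ 1 + ‖ℓ‖ := by
          calc ‖1 - ℓ‖ ≤ ‖(1 : ℂ)‖ + ‖ℓ‖ := norm_sub_le _ _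
            _ = 1 + ‖ℓ‖ := by rw [norm_one]
        linarith

/-- `|T_s(z)| ≤ ∑_{m<S} |f^{(m)}(c_s)|/m! · |z - c_s|^m`. [folklore] -/
theorem norm_taylorPoly_eval_le (f : ℂ → ℂ) (s : Fin h) (z : ℂ) :
    ‖(taylorPoly c S f s).eval z‖ ≤
      ∑ m ∈ Finset.range S, ‖iteratedDeriv m f (c s)‖ / m.factorial * ‖z - c s‖ ^ m := by
  unfold taylorPoly
  rw [eval_finsetSum]
  refine (norm_sum_le _ _).trans (le_of_eq (Finset.sum_congr rfl fun m _ => ?_))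
  rw [eval_mul, eval_C, eval_pow, eval_sub, eval_X, eval_C, norm_mul, norm_pow, norm_div,
    Complex.norm_natCast]

/-- **Size of the quasi-interpolant**:
`|q(z)| ≤ ∑_s (∑_{m<S} |f^{(m)}(c_s)|/m! |z - c_s|^m) (1 + 2|ℓ_s(z)|)^{2S-1}` — explicit in the
small derivatives (Masser's terms `φ_m(s+¼)/m! · I(m, s)` of (14)). [cite: Masser1975, §1.3 (proof of Lemma 1.10, eq. (14))] -/
theorem norm_quasiInterp_le (f : ℂ → ℂ) (z : ℂ) :
    ‖(quasiInterp c S f).eval z‖ ≤ ∑ s, (∑ m ∈ Finset.range S,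
      ‖iteratedDeriv m f (c s)‖ / m.factorial * ‖z - c s‖ ^ m) *
        (1 + 2 * ‖(Lagrange.basis univ c s).eval z‖) ^ (2 * S - 1) := by
  unfold quasiInterp
  rw [eval_finsetSum]
  refine (norm_sum_le _ _).trans (Finset.sum_le_sum fun s _ => ?_)
  rw [eval_mul, norm_mul]
  exact mul_le_mul (norm_taylorPoly_eval_le c S f s z) (norm_bump_eval_le c S s z)
    (norm_nonneg _) (Finset.sum_nonneg fun m _ => by positivity)

/-! ### The estimate -/

/-- **Maximum modulus with approximate zeros** (replacing eq. (14) of the book): let `f` be entire,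
`c₁, …, c_h` distinct, `S ≥ 1`, `q` the quasi-interpolant. If `|f - q| ≤ θ` on `|z| = R` and
`|F| ≥ m > 0` there (`F(z) = ∏_s (z - c_s)^S`), then for `|w| ≤ R`,
`|f(w)| ≤ |q(w)| + (θ/m) |F(w)|`. With exact zeros (`f^{(m)}(c_s) = 0`, `m < S`) `q = 0` and
this is Baker's Lemma. [cite: Masser1975, §1.3 (proof of Lemma 1.10, eq. (14))] -/
theorem norm_le_of_small_derivs {f : ℂ → ℂ} (hf : Differentiable ℂ f) (hc : Function.Injective c)
    (hS : 1 ≤ S) {R θ m : ℝ} (hR : 0 < R)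
    (hθ : ∀ z ∈ sphere (0 : ℂ) R, ‖f z - (quasiInterp c S f).eval z‖ ≤ θ) (hm : 0 < m)
    (hmF : ∀ z ∈ sphere (0 : ℂ) R, m ≤ ‖∏ s, (z - c s) ^ S‖) {w : ℂ} (hw : ‖w‖ ≤ R) :
    ‖f w‖ ≤ ‖(quasiInterp c S f).eval w‖ + θ / m * ‖∏ s, (w - c s) ^ S‖ := by
  classical
  set g : ℂ → ℂ := fun z => f z - (quasiInterp c S f).eval z with hg
  have hgd : Differentiable ℂ g := hf.sub (Polynomial.differentiable _)
  have hprod : ∀ z : ℂ, ∏ c' ∈ (univ : Finset (Fin h)).image c, (z - c') ^ S = ∏ s, (z - c s) ^ S :=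
    fun z => Finset.prod_image fun x _ y _ hxy => hc hxy
  have hord : ∀ c' ∈ (univ : Finset (Fin h)).image c, (S : ℕ∞) ≤ analyticOrderAt g c' := by
    intro c' hc'
    obtain ⟨s, -, rfl⟩ := Finset.mem_image.mp hc'
    exact le_analyticOrderAt_sub_quasiInterp c S hf hc hS s
  have hmF' : ∀ z ∈ sphere (0 : ℂ) R, m ≤ ‖∏ c' ∈ (univ : Finset (Fin h)).image c, (z - c') ^ S‖ :=
    fun z hz => by rw [hprod]; exact hmF z hz
  have key := Baker1975.Analytic.norm_le_of_analyticOrderAt hgd _ S hord hR hθ hm hmF' hw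
  rw [hprod] at key
  calc ‖f w‖ = ‖g w + (quasiInterp c S f).eval w‖ := by simp [hg]
    _ ≤ ‖g w‖ + ‖(quasiInterp c S f).eval w‖ := norm_add_le _ _
    _ ≤ θ / m * ‖∏ s, (w - c s) ^ S‖ + ‖(quasiInterp c S f).eval w‖ := by gcongr
    _ = ‖(quasiInterp c S f).eval w‖ + θ / m * ‖∏ s, (w - c s) ^ S‖ := add_comm _ _

end Literature.NumberTheory.Transcendental.Masser1975
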